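import Literature.Analysis.FluidPDE.Vorticity
import Literature.Analysis.FluidPDE.HardyVectorField
import Literature.Analysis.FluidPDE.SobolevPotentialBound
import Mathlib.Analysis.Calculus.BumpFunction.InnerProduct
import Mathlib.Analysis.InnerProductSpace.Adjoint
import HarnessLib

/-!
# The vortex-stretching rate `α = ξ · (∇v) ξ` and the binding energy of the stretching well

Analysis/FluidPDE definitions file (requested by route `StretchingWellBinding` of
`NavierStokesRegularity`, whose items inline the expressions below). Let `v : ℝ³ → ℝ³` be a
velocity field, `ω = curl v`, and `ξ = ω/|ω|` (`vorticityDirection`, junk `0` where `ω = 0`).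

* `stretchingRate v x = ⟪ξ(x), Dv(x) ξ(x)⟫` — the **vortex-line-stretching factor**
  `S = 𝒟ξ · ξ` of Majda–Bertozzi, eq. (5.9) (`𝒟 = ½(∇v + ∇vᵀ)`; the antisymmetric part drops
  out, `stretchingRate_eq_inner_symm`), i.e. the stretching rate `α = (Sξ)·ξ` of Constantin (1994)
  and Constantin–Fefferman (1993). It is `0` where `ω = 0` (as in (5.9)); `|ω|² α = ⟪ω, (∇v) ω⟫`
  everywhere (`norm_curl_sq_mul_stretchingRate`, the stretching term of the enstrophy balance);
  `|α| ≤ ‖Dv(x)‖` (Majda–Bertozzi (5.12)); measurable for `C¹` fields.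
* `bindingForm ν v ψ = ∫ α₊ |ψ|² − ν ∫ |∇ψ|²_F` — the quadratic form of `νΔ + α₊` on vector test
  fields (`α₊ = max 0 α`, Frobenius norm of `Dψ`).
* `IsAdmissibleBindingRate ν u S Λ` — for `u : ℝ → ℝ³ → ℝ³`: `Λ t` bounds the form at every
  `t ∈ S`, `∫ α₊(t)|ψ|² − ν ∫ |∇ψ|²_F ≤ Λ(t) ∫ |ψ|²` for all smooth compactly supported `ψ` —
  **verbatim** the hypothesis of the route's `BindingCriterion` (`Iff.rfl` restates it).
* `bindingQuotients ν v`, `bindingEnergy ν v = sSup (bindingQuotients ν v)` — the Rayleigh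
  quotients `bindingForm ν v ψ / ∫|ψ|²` over nonzero smooth compactly supported `ψ` and their
  supremum `= sup spec(νΔ + α₊)` ("binding energy of the stretching well"). Real-valued:
  meaningful when the quotients are bounded above (e.g. `α₊` bounded), junk `Real.sSup` value
  otherwise; the set is never empty (`bindingQuotients_nonempty`).

## Main statements (all proved)

* `IsAdmissibleBindingRate.bindingEnergy_le` (admissible rates dominate the binding energy),
  `isAdmissibleBindingRate_bindingEnergy` (the binding energy is admissible once finite),
  `bindingEnergy_le_of_stretchingRate_le` (`Λ ≤ sup α₊ ≤ ‖∇v‖_∞` for `ν ≥ 0`).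
* **Hardy face** `bindingForm_nonpos_of_hardy`: `|x − x₀|² α₊ ≤ ν/4` everywhere ⇒ form `≤ 0`
  (vector Hardy inequality with sharp constant `4`, `HardyVectorField.lean`).
* **Sobolev face** `bindingForm_nonpos_of_sobolev`: `(∫ α₊^{3/2})^{2/3} · C² ≤ ν` ⇒ form `≤ 0`,
  `C` Mathlib's Gagliardo–Nirenberg–Sobolev constant of `ℝ³` (`SobolevPotentialBound.lean`; not
  the sharp Talenti constant).

Not here: the equality of the scalar and vector Rayleigh suprema (Kato's inequality).

## References

* A. J. Majda, A. L. Bertozzi, *Vorticity and Incompressible Flow* (CUP 2002), §5.1, eqs. (5.8),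
  (5.9), Thm. 5.1 and (5.12) (key `MajdaBertozziCUP2002`).
* P. Constantin, *Geometric statistics in turbulence*, SIAM Review 36 (1994) 73–98
  (key `Constantin1994`): `α = (∇u ξ)·ξ = (Sξ)·ξ`.
* P. Constantin, C. Fefferman, *Direction of vorticity and the problem of global regularity for
  the Navier–Stokes equations*, Indiana Univ. Math. J. 42 (1993) 775–789
  (key `ConstantinFefferman1993`), §1.
-/


noncomputable section

open MeasureTheory Set Function Filter
open scoped RealInnerProductSpace NNReal

namespace Literature.Analysis.FluidPDE

/-- Local notation for physical space `ℝ³ = EuclideanSpace ℝ (Fin 3)`. -/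
local notation "ℝ³" => EuclideanSpace ℝ (Fin 3)

/-! ### The stretching rate -/

/-- The **vortex-stretching rate** `α(x) = ⟪ξ(x), Dv(x) ξ(x)⟫` of a velocity field `v : ℝ³ → ℝ³`,
where `ξ = ω/|ω|` is the vorticity direction (`vorticityDirection (curl v)`): the
vortex-line-stretching factor `S = 𝒟ξ·ξ` of Majda–Bertozzi, eq. (5.9) (`d|ω|/dt = S|ω|` along
particle paths, eq. (5.8)), alias `α = (Sξ)·ξ` of Constantin (1994) / Constantin–Fefferman (1993);
the antisymmetric part of `Dv` does not contribute (`stretchingRate_eq_inner_symm`). Junk value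
`0` where `curl v x = 0` (as in (5.9)) or where `v` is not differentiable. For a time-dependent
field `u : ℝ → ℝ³ → ℝ³` use `stretchingRate (u t) x`.
[cite: MajdaBertozziCUP2002, §5.1 eq. (5.9)] -/
def stretchingRate (v : ℝ³ → ℝ³) (x : ℝ³) : ℝ :=
  ⟪vorticityDirection (curl v) x, fderiv ℝ v x (vorticityDirection (curl v) x)⟫

/-- Unfolding `stretchingRate` — literally the expression inlined by the route items (`rfl`).
[cite: MajdaBertozziCUP2002, §5.1 eq. (5.9)] -/
theorem stretchingRate_def (v : ℝ³ → ℝ³) (x : ℝ³) :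
    stretchingRate v x =
      inner ℝ (vorticityDirection (curl v) x) ((fderiv ℝ v x) (vorticityDirection (curl v) x)) :=
  rfl

/-- The vorticity direction has norm at most one (`1` where `ω ≠ 0`, junk `0` where `ω = 0`).
[folklore] -/
theorem norm_vorticityDirection_le_one (w : ℝ³ → ℝ³) (x : ℝ³) :
    ‖vorticityDirection w x‖ ≤ 1 := by
  by_cases h : w x = 0
  · rw [(vorticityDirection_eq_zero_iff w x).2 h, norm_zero]
    exact zero_le_one
  · exact (norm_vorticityDirection w h).le

/-- Where the vorticity vanishes the stretching rate takes the junk value `0`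
(Majda–Bertozzi (5.9), case `ξ = 0`). [cite: MajdaBertozziCUP2002, §5.1 eq. (5.9)] -/
theorem stretchingRate_eq_zero_of_curl_eq_zero {v : ℝ³ → ℝ³} {x : ℝ³} (h : curl v x = 0) :
    stretchingRate v x = 0 := by
  rw [stretchingRate, (vorticityDirection_eq_zero_iff (curl v) x).2 h, inner_zero_left]

/-- `α = |ω|⁻² ⟪ω, Dv ω⟫` everywhere (both sides vanish where `ω = 0`). [folklore] -/
theorem stretchingRate_eq_inv_mul_inner (v : ℝ³ → ℝ³) (x : ℝ³) :
    stretchingRate v x = (‖curl v x‖ ^ 2)⁻¹ * ⟪curl v x, fderiv ℝ v x (curl v x)⟫ := by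
  rw [stretchingRate, vorticityDirection_apply, map_smul, real_inner_smul_left,
    real_inner_smul_right]
  ring

/-- **The stretching term of the enstrophy balance**: `|ω(x)|² α(x) = ⟪ω(x), Dv(x) ω(x)⟫`
for every `x` (`ω = curl v`; Majda–Bertozzi (5.8): `d|ω|/dt = S|ω|`).
[cite: MajdaBertozziCUP2002, §5.1 eq. (5.8)–(5.9)] -/
theorem norm_curl_sq_mul_stretchingRate (v : ℝ³ → ℝ³) (x : ℝ³) :
    ‖curl v x‖ ^ 2 * stretchingRate v x = ⟪curl v x, fderiv ℝ v x (curl v x)⟫ := by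
  rw [stretchingRate_eq_inv_mul_inner]
  by_cases h : curl v x = 0
  · simp [h]
  · have : ‖curl v x‖ ^ 2 ≠ 0 := pow_ne_zero _ (norm_ne_zero_iff.2 h)
    field_simp

/-- `|α(x)| ≤ ‖Dv(x)‖` (operator norm): the stretching rate is dominated by the velocity gradient
(Majda–Bertozzi, (5.12): `max S ≤ |𝒟|_∞ ≤ C|∇v|_∞`).
[cite: MajdaBertozziCUP2002, §5.1 eq. (5.12)] -/
theorem abs_stretchingRate_le (v : ℝ³ → ℝ³) (x : ℝ³) : |stretchingRate v x| ≤ ‖fderiv ℝ v x‖ := by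
  have hξ : ‖vorticityDirection (curl v) x‖ ≤ 1 := norm_vorticityDirection_le_one _ _
  have h0 : 0 ≤ ‖vorticityDirection (curl v) x‖ := norm_nonneg _
  calc |stretchingRate v x|
      ≤ ‖vorticityDirection (curl v) x‖ * ‖fderiv ℝ v x (vorticityDirection (curl v) x)‖ :=
        abs_real_inner_le_norm _ _
    _ ≤ ‖vorticityDirection (curl v) x‖ * (‖fderiv ℝ v x‖ * ‖vorticityDirection (curl v) x‖) := by
        gcongr
        exact ContinuousLinearMap.le_opNorm _ _
    _ ≤ 1 * (‖fderiv ℝ v x‖ * 1) := by gcongr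
    _ = ‖fderiv ℝ v x‖ := by ring

/-- `α(x) ≤ ‖Dv(x)‖`. [cite: MajdaBertozziCUP2002, §5.1 eq. (5.12)] -/
theorem stretchingRate_le_norm_fderiv (v : ℝ³ → ℝ³) (x : ℝ³) :
    stretchingRate v x ≤ ‖fderiv ℝ v x‖ :=
  (le_abs_self _).trans (abs_stretchingRate_le v x)

/-- **The antisymmetric part drops out**: `α = ⟪ξ, 𝒟 ξ⟫` with the deformation (rate-of-strain)
matrix `𝒟 = ½(Dv + Dvᵀ)` (Majda–Bertozzi (5.5), (5.9)).
[cite: MajdaBertozziCUP2002, §5.1 eq. (5.9)] -/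
theorem stretchingRate_eq_inner_symm (v : ℝ³ → ℝ³) (x : ℝ³) :
    stretchingRate v x =
      ⟪vorticityDirection (curl v) x,
        ((2 : ℝ)⁻¹ • (fderiv ℝ v x + ContinuousLinearMap.adjoint (fderiv ℝ v x)))
          (vorticityDirection (curl v) x)⟫ := by
  rw [stretchingRate, FunLike.coe_smul, FunLike.coe_add, Pi.smul_apply,
    Pi.add_apply, real_inner_smul_right, inner_add_right, ContinuousLinearMap.adjoint_inner_right,
    real_inner_comm (vorticityDirection (curl v) x) (fderiv ℝ v x (vorticityDirection (curl v) x))]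
  ring

/-- The stretching rate of a `C¹` field is (Borel) measurable — it is `|ω|⁻² ⟪ω, Dv ω⟫` with
`ω`, `Dv` continuous (it is in general discontinuous across `{ω = 0}`). [folklore] -/
theorem measurable_stretchingRate {v : ℝ³ → ℝ³} (hv : ContDiff ℝ 1 v) :
    Measurable (stretchingRate v) := by
  have h1 : Continuous (curl v) := continuous_curl hv
  have h3 : Continuous fun x => ⟪curl v x, fderiv ℝ v x (curl v x)⟫ :=
    h1.inner ((hv.continuous_fderiv one_ne_zero).clm_apply h1)
  rw [show stretchingRate v = _ from funext (stretchingRate_eq_inv_mul_inner v)]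
  exact ((h1.norm.pow 2).measurable.inv).mul h3.measurable

/-! ### The binding form, admissible binding rates, the binding energy -/

/-- The **binding form** of the stretching well with viscosity `ν`:
`bindingForm ν v ψ = ∫ α₊ |ψ|² − ν ∫ |∇ψ|²_F` for a vector test field `ψ : ℝ³ → ℝ³`
(`α₊ = max 0 (stretchingRate v ·)`, `|∇ψ|²_F = frobeniusNormSq (Dψ)`), the quadratic form of
`νΔ + α₊`. Bochner integrals (junk `0` for non-integrable integrands; both are genuine for `ψ`
`C¹` with compact support and `α₊` locally integrable). [folklore] -/
def bindingForm (ν : ℝ) (v ψ : ℝ³ → ℝ³) : ℝ :=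
  (∫ x, max 0 (stretchingRate v x) * ‖ψ x‖ ^ 2) - ν * ∫ x, frobeniusNormSq (fderiv ℝ ψ x)

/-- An **admissible binding rate** for a time-dependent field `u : ℝ → ℝ³ → ℝ³` on a set of times
`S`: `Λ : ℝ → ℝ` bounds the stretching well's Rayleigh quotient at every `t ∈ S`,
`∫ α₊(t)|ψ|² − ν ∫ |∇ψ|²_F ≤ Λ(t) ∫ |ψ|²` for every smooth compactly supported `ψ : ℝ³ → ℝ³`
(i.e. `Λ(t) ≥ sup spec(νΔ + α₊(t))`). Stated **verbatim** as the hypothesis of the route item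
`BindingCriterion` (route `StretchingWellBinding`), with `stretchingRate (u t) x` for the inlined
inner product. [folklore] -/
def IsAdmissibleBindingRate (ν : ℝ) (u : ℝ → ℝ³ → ℝ³) (S : Set ℝ) (Λ : ℝ → ℝ) : Prop :=
  ∀ t ∈ S, ∀ ψ : ℝ³ → ℝ³, ContDiff ℝ (⊤ : ℕ∞) ψ → HasCompactSupport ψ →
    (∫ x, max 0 (stretchingRate (u t) x) * ‖ψ x‖ ^ 2) -
        ν * (∫ x, frobeniusNormSq (fderiv ℝ ψ x)) ≤ Λ t * ∫ x, ‖ψ x‖ ^ 2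

/-- Admissibility in terms of the binding form (`Iff.rfl`). [folklore] -/
theorem isAdmissibleBindingRate_iff {ν : ℝ} {u : ℝ → ℝ³ → ℝ³} {S : Set ℝ} {Λ : ℝ → ℝ} :
    IsAdmissibleBindingRate ν u S Λ ↔
      ∀ t ∈ S, ∀ ψ : ℝ³ → ℝ³, ContDiff ℝ (⊤ : ℕ∞) ψ → HasCompactSupport ψ →
        bindingForm ν (u t) ψ ≤ Λ t * ∫ x, ‖ψ x‖ ^ 2 :=
  Iff.rfl

/-- Admissible rates are stable under increase and under shrinking the time set. [folklore] -/
theorem IsAdmissibleBindingRate.mono {ν : ℝ} {u : ℝ → ℝ³ → ℝ³} {S S' : Set ℝ} {Λ Λ' : ℝ → ℝ}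
    (h : IsAdmissibleBindingRate ν u S Λ) (hS : S' ⊆ S) (hΛ : ∀ t ∈ S', Λ t ≤ Λ' t) :
    IsAdmissibleBindingRate ν u S' Λ' := fun t ht ψ h1 h2 =>
  (h t (hS ht) ψ h1 h2).trans
    (mul_le_mul_of_nonneg_right (hΛ t ht) (integral_nonneg fun _ => sq_nonneg _))

/-- The **Rayleigh quotients of the stretching well**: `(∫ α₊|ψ|² − ν∫|∇ψ|²_F) / ∫|ψ|²` over
nonzero smooth compactly supported vector fields `ψ`. [folklore] -/
def bindingQuotients (ν : ℝ) (v : ℝ³ → ℝ³) : Set ℝ :=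
  {q | ∃ ψ : ℝ³ → ℝ³, ContDiff ℝ (⊤ : ℕ∞) ψ ∧ HasCompactSupport ψ ∧ ψ ≠ 0 ∧
    q = bindingForm ν v ψ / ∫ x, ‖ψ x‖ ^ 2}

/-- The **binding energy of the stretching well**, `Λ(v) = sup_ψ (∫ α₊|ψ|² − ν∫|∇ψ|²_F)/∫|ψ|²
= sup spec(νΔ + α₊)`: the supremum of the Rayleigh quotients `bindingQuotients ν v`. Real-valued;
junk value (`Real.sSup` of a set that is not bounded above) when the quotients are unbounded —
use together with `BddAbove (bindingQuotients ν v)`, which holds e.g. when `α₊` is bounded.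
[folklore] -/
def bindingEnergy (ν : ℝ) (v : ℝ³ → ℝ³) : ℝ :=
  sSup (bindingQuotients ν v)

/-- There is a nonzero smooth compactly supported vector field on `ℝ³` (a bump times `e₀`).
[folklore] -/
theorem exists_smooth_test_field :
    ∃ ψ : ℝ³ → ℝ³, ContDiff ℝ (⊤ : ℕ∞) ψ ∧ HasCompactSupport ψ ∧ ψ ≠ 0 := by
  let f : ContDiffBump (0 : ℝ³) := ⟨1, 2, one_pos, one_lt_two⟩
  refine ⟨fun x => f x • EuclideanSpace.single 0 1, f.contDiff.smul contDiff_const,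
    f.hasCompactSupport.smul_right, fun h => ?_⟩
  have h1 : f 0 = 1 := f.one_of_mem_closedBall (Metric.mem_closedBall_self f.rIn_pos.le)
  have h2 := congrFun h 0
  simp only [h1, one_smul, Pi.zero_apply] at h2
  have h3 := congrArg (fun w : ℝ³ => w 0) h2
  simp at h3

/-- The set of Rayleigh quotients is never empty. [folklore] -/
theorem bindingQuotients_nonempty (ν : ℝ) (v : ℝ³ → ℝ³) : (bindingQuotients ν v).Nonempty := by
  obtain ⟨ψ, h1, h2, h3⟩ := exists_smooth_test_field
  exact ⟨_, ψ, h1, h2, h3, rfl⟩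

/-- A bound on the form over all test fields bounds the binding energy:
if `bindingForm ν v ψ ≤ Λ ∫|ψ|²` for all smooth compactly supported `ψ` then
`bindingEnergy ν v ≤ Λ`.
[folklore] -/
theorem bindingEnergy_le_of_forall {ν Λ : ℝ} {v : ℝ³ → ℝ³}
    (h : ∀ ψ : ℝ³ → ℝ³, ContDiff ℝ (⊤ : ℕ∞) ψ → HasCompactSupport ψ →
      bindingForm ν v ψ ≤ Λ * ∫ x, ‖ψ x‖ ^ 2) :
    bindingEnergy ν v ≤ Λ := by
  refine csSup_le (bindingQuotients_nonempty ν v) ?_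
  rintro q ⟨ψ, h1, h2, h3, rfl⟩
  rw [div_le_iff₀ (integral_norm_sq_pos_of_hasCompactSupport h1.continuous h2 h3)]
  exact h ψ h1 h2

/-- Under the same bound the Rayleigh quotients are bounded above (the binding energy is a genuine
supremum). [folklore] -/
theorem bddAbove_bindingQuotients_of_forall {ν Λ : ℝ} {v : ℝ³ → ℝ³}
    (h : ∀ ψ : ℝ³ → ℝ³, ContDiff ℝ (⊤ : ℕ∞) ψ → HasCompactSupport ψ →
      bindingForm ν v ψ ≤ Λ * ∫ x, ‖ψ x‖ ^ 2) :
    BddAbove (bindingQuotients ν v) := by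
  refine ⟨Λ, ?_⟩
  rintro q ⟨ψ, h1, h2, h3, rfl⟩
  rw [div_le_iff₀ (integral_norm_sq_pos_of_hasCompactSupport h1.continuous h2 h3)]
  exact h ψ h1 h2

/-- **Any admissible rate dominates the binding energy**: `bindingEnergy ν (u t) ≤ Λ t` for
`t ∈ S`. [folklore] -/
theorem IsAdmissibleBindingRate.bindingEnergy_le {ν : ℝ} {u : ℝ → ℝ³ → ℝ³} {S : Set ℝ}
    {Λ : ℝ → ℝ} (h : IsAdmissibleBindingRate ν u S Λ) {t : ℝ} (ht : t ∈ S) :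
    bindingEnergy ν (u t) ≤ Λ t :=
  bindingEnergy_le_of_forall (h t ht)

/-- The binding form of the zero test field vanishes. [folklore] -/
@[simp]
theorem bindingForm_zero (ν : ℝ) (v : ℝ³ → ℝ³) : bindingForm ν v 0 = 0 := by
  simp [bindingForm, Pi.zero_def]

/-- **Rayleigh's inequality**: when the quotients are bounded above,
`bindingForm ν v ψ ≤ bindingEnergy ν v · ∫|ψ|²` for every smooth compactly supported `ψ`.
[folklore] -/
theorem bindingForm_le_bindingEnergy_mul {ν : ℝ} {v : ℝ³ → ℝ³}
    (hb : BddAbove (bindingQuotients ν v)) {ψ : ℝ³ → ℝ³} (h1 : ContDiff ℝ (⊤ : ℕ∞) ψ)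
    (h2 : HasCompactSupport ψ) : bindingForm ν v ψ ≤ bindingEnergy ν v * ∫ x, ‖ψ x‖ ^ 2 := by
  by_cases h3 : ψ = 0
  · subst h3
    simp
  · have hq : bindingForm ν v ψ / ∫ x, ‖ψ x‖ ^ 2 ≤ bindingEnergy ν v :=
      le_csSup hb ⟨ψ, h1, h2, h3, rfl⟩
    rwa [div_le_iff₀ (integral_norm_sq_pos_of_hasCompactSupport h1.continuous h2 h3)] at hq

/-- **The binding energy is itself an admissible rate** on any set of times where it is finite
(quotients bounded above): `Λ(t) := bindingEnergy ν (u t)` is the least admissible rate.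
[folklore] -/
theorem isAdmissibleBindingRate_bindingEnergy {ν : ℝ} {u : ℝ → ℝ³ → ℝ³} {S : Set ℝ}
    (hb : ∀ t ∈ S, BddAbove (bindingQuotients ν (u t))) :
    IsAdmissibleBindingRate ν u S fun t => bindingEnergy ν (u t) := fun t ht _ h1 h2 =>
  bindingForm_le_bindingEnergy_mul (hb t ht) h1 h2

/-- A pointwise bound `α ≤ M` (`M ≥ 0`, `ν ≥ 0`) bounds the form: `bindingForm ν v ψ ≤ M ∫|ψ|²`
for continuous compactly supported `ψ` (drop the dissipation, `α₊ ≤ M`). [folklore] -/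
theorem bindingForm_le_of_stretchingRate_le {ν M : ℝ} {v ψ : ℝ³ → ℝ³} (hν : 0 ≤ ν) (hM : 0 ≤ M)
    (hα : ∀ x, stretchingRate v x ≤ M) (hψ : Continuous ψ) (hc : HasCompactSupport ψ) :
    bindingForm ν v ψ ≤ M * ∫ x, ‖ψ x‖ ^ 2 := by
  have hint : Integrable fun x => M * ‖ψ x‖ ^ 2 :=
    ((hψ.norm.pow 2).integrable_of_hasCompactSupport (hasCompactSupport_norm_sq hc)).const_mul M
  have h1 : ∫ x, max 0 (stretchingRate v x) * ‖ψ x‖ ^ 2 ≤ ∫ x, M * ‖ψ x‖ ^ 2 :=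
    integral_mono_of_nonneg (ae_of_all _ fun x => mul_nonneg (le_max_left _ _) (sq_nonneg _))
      hint (ae_of_all _ fun x => mul_le_mul_of_nonneg_right (max_le hM (hα x)) (sq_nonneg _))
  have h2 : 0 ≤ ν * ∫ x, frobeniusNormSq (fderiv ℝ ψ x) :=
    mul_nonneg hν (integral_nonneg fun x => frobeniusNormSq_nonneg _)
  rw [integral_const_mul] at h1
  rw [bindingForm]
  linarith

/-- `Λ ≤ sup α₊`: a pointwise bound `α ≤ M` (`M, ν ≥ 0`) bounds the binding energy by `M`.
[folklore] -/
theorem bindingEnergy_le_of_stretchingRate_le {ν M : ℝ} {v : ℝ³ → ℝ³} (hν : 0 ≤ ν) (hM : 0 ≤ M)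
    (hα : ∀ x, stretchingRate v x ≤ M) : bindingEnergy ν v ≤ M :=
  bindingEnergy_le_of_forall fun _ h1 h2 =>
    bindingForm_le_of_stretchingRate_le hν hM hα h1.continuous h2

/-! ### The Hardy face: `|x − x₀|² α₊ ≤ ν/4` forbids binding -/

/-- **The Hardy face of the stretching well.** If the positive stretching is Hardy-subcritical
about some centre, `|x − x₀|² α₊(x) ≤ ν/4` for all `x`, then the binding form is nonpositive on
every `C¹` compactly supported test field: `∫ α₊|ψ|² ≤ (ν/4) ∫ |ψ|²/|x−x₀|² ≤ ν ∫ |∇ψ|²_F` by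
Hardy's inequality with its sharp constant `4`. [folklore] -/
theorem bindingForm_nonpos_of_hardy {ν : ℝ} {v ψ : ℝ³ → ℝ³} {x₀ : ℝ³}
    (hH : ∀ x, ‖x - x₀‖ ^ 2 * max 0 (stretchingRate v x) ≤ ν / 4) (hψ : ContDiff ℝ 1 ψ)
    (hc : HasCompactSupport ψ) : bindingForm ν v ψ ≤ 0 := by
  have hν : 0 ≤ ν := by
    have := hH x₀
    rw [sub_self, norm_zero, zero_pow two_ne_zero, zero_mul] at this
    linarith
  -- a.e. pointwise comparison (off the null set `{x₀}`)
  have hne : ∀ᵐ x ∂(volume : Measure ℝ³), x ≠ x₀ := by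
    have : ({x₀}ᶜ : Set ℝ³) ∈ ae (volume : Measure ℝ³) := compl_mem_ae_iff.2 (measure_singleton x₀)
    filter_upwards [this] with x hx using hx
  have hle : ∀ᵐ x ∂(volume : Measure ℝ³), max 0 (stretchingRate v x) * ‖ψ x‖ ^ 2 ≤
      ν / 4 * (‖ψ x‖ ^ 2 / ‖x - x₀‖ ^ 2) := by
    filter_upwards [hne] with x hx
    have hr' : ‖x - x₀‖ ≠ 0 := norm_ne_zero_iff.2 (sub_ne_zero.2 hx)
    have hr : 0 < ‖x - x₀‖ ^ 2 := by positivity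
    have hψ2 : 0 ≤ ‖ψ x‖ ^ 2 / ‖x - x₀‖ ^ 2 := div_nonneg (sq_nonneg _) hr.le
    calc max 0 (stretchingRate v x) * ‖ψ x‖ ^ 2
        = (‖x - x₀‖ ^ 2 * max 0 (stretchingRate v x)) * (‖ψ x‖ ^ 2 / ‖x - x₀‖ ^ 2) := by
          field_simp
      _ ≤ ν / 4 * (‖ψ x‖ ^ 2 / ‖x - x₀‖ ^ 2) := mul_le_mul_of_nonneg_right (hH x) hψ2
  have h1 : ∫ x, max 0 (stretchingRate v x) * ‖ψ x‖ ^ 2 ≤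
      ∫ x, ν / 4 * (‖ψ x‖ ^ 2 / ‖x - x₀‖ ^ 2) :=
    integral_mono_of_nonneg (ae_of_all _ fun x => mul_nonneg (le_max_left _ _) (sq_nonneg _))
      ((integrable_norm_sq_div_norm_sub_sq hψ hc x₀).const_mul _) hle
  rw [integral_const_mul] at h1
  have h2 := integral_norm_sq_div_norm_sub_sq_le hψ hc x₀
  have h3 : ν / 4 * ∫ x, ‖ψ x‖ ^ 2 / ‖x - x₀‖ ^ 2 ≤ ν * ∫ x, frobeniusNormSq (fderiv ℝ ψ x) := by
    have := mul_le_mul_of_nonneg_left h2 (by positivity : 0 ≤ ν / 4)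
    linarith
  rw [bindingForm]
  linarith

/-- Hardy-subcritical stretching does not bind: `bindingEnergy ν v ≤ 0`. [folklore] -/
theorem bindingEnergy_nonpos_of_hardy {ν : ℝ} {v : ℝ³ → ℝ³} {x₀ : ℝ³}
    (hH : ∀ x, ‖x - x₀‖ ^ 2 * max 0 (stretchingRate v x) ≤ ν / 4) : bindingEnergy ν v ≤ 0 := by
  refine bindingEnergy_le_of_forall fun ψ h1 h2 => ?_
  rw [zero_mul]
  exact bindingForm_nonpos_of_hardy hH (h1.of_le (by exact_mod_cast le_top)) h2

/-- Hardy-subcritical stretching at every time of `S` (the centre may move) makes `Λ = 0` an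
admissible binding rate. [folklore] -/
theorem isAdmissibleBindingRate_zero_of_hardy {ν : ℝ} {u : ℝ → ℝ³ → ℝ³} {S : Set ℝ}
    (hH : ∀ t ∈ S, ∃ x₀ : ℝ³, ∀ x, ‖x - x₀‖ ^ 2 * max 0 (stretchingRate (u t) x) ≤ ν / 4) :
    IsAdmissibleBindingRate ν u S 0 := by
  intro t ht ψ h1 h2
  obtain ⟨x₀, hx₀⟩ := hH t ht
  rw [Pi.zero_apply, zero_mul]
  exact bindingForm_nonpos_of_hardy hx₀ (h1.of_le (by exact_mod_cast le_top)) h2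

/-! ### The Sobolev face: `‖α₊‖_{3/2}` small forbids binding -/

/-- **The Sobolev face of the stretching well.** If the positive stretching is small in
`L^{3/2}`, `(∫ α₊^{3/2})^{2/3} · C² ≤ ν` with `C` Mathlib's Gagliardo–Nirenberg–Sobolev constant of
`ℝ³` for `p = 2` (the sharp threshold would carry Talenti's constant instead), then the binding
form is nonpositive on every `C¹` compactly supported test field:
`∫ α₊|ψ|² ≤ ‖α₊‖_{3/2} ‖ψ‖²_{L⁶} ≤ ‖α₊‖_{3/2} C² ∫|∇ψ|²_F` (Hölder + Sobolev,
`integral_mul_norm_sq_le_sobolev`). [folklore] -/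
theorem bindingForm_nonpos_of_sobolev {ν : ℝ} {v ψ : ℝ³ → ℝ³}
    (hα : MemLp (fun x => max 0 (stretchingRate v x)) (ENNReal.ofReal (3 / 2)) volume)
    (hsmall : (∫ x, (max 0 (stretchingRate v x)) ^ (3 / 2 : ℝ)) ^ (2 / 3 : ℝ) *
      ((eLpNormLESNormFDerivOfEqInnerConst (volume : Measure ℝ³) 2 : ℝ≥0) : ℝ) ^ 2 ≤ ν)
    (hψ : ContDiff ℝ 1 ψ) (hc : HasCompactSupport ψ) : bindingForm ν v ψ ≤ 0 := by
  have h := integral_mul_norm_sq_le_sobolev (V := fun x => max 0 (stretchingRate v x))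
    (ae_of_all _ fun x => le_max_left _ _) hα hψ hc
  rw [← mul_assoc] at h
  have hF : 0 ≤ ∫ x, frobeniusNormSq (fderiv ℝ ψ x) :=
    integral_nonneg fun _ => frobeniusNormSq_nonneg _
  have h2 := mul_le_mul_of_nonneg_right hsmall hF
  rw [bindingForm]
  linarith

/-- `L^{3/2}`-small stretching does not bind: `bindingEnergy ν v ≤ 0`. [folklore] -/
theorem bindingEnergy_nonpos_of_sobolev {ν : ℝ} {v : ℝ³ → ℝ³}
    (hα : MemLp (fun x => max 0 (stretchingRate v x)) (ENNReal.ofReal (3 / 2)) volume)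
    (hsmall : (∫ x, (max 0 (stretchingRate v x)) ^ (3 / 2 : ℝ)) ^ (2 / 3 : ℝ) *
      ((eLpNormLESNormFDerivOfEqInnerConst (volume : Measure ℝ³) 2 : ℝ≥0) : ℝ) ^ 2 ≤ ν) :
    bindingEnergy ν v ≤ 0 := by
  refine bindingEnergy_le_of_forall fun ψ h1 h2 => ?_
  rw [zero_mul]
  exact bindingForm_nonpos_of_sobolev hα hsmall (h1.of_le (by exact_mod_cast le_top)) h2

end Literature.Analysis.FluidPDE

end
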